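import Literature.NumberTheory.Sieve.SmoothMajorantAssembly
import HarnessLib

/-!
# Green–Tao (2008), Proposition 9.6 up to constants — the core: Selberg's change of variables in a product probability space

Trunk T-SIEVE. Second brick (after `CoprimeMoebiusLogSums`) of the tree's ELEMENTARY proof of the
upper bound in B. Green, T. Tao, *The primes contain arbitrarily long arithmetic progressions*,
Ann. of Math. 167 (2008), Proposition 9.6, in the weak form "`O_m(1)`" in place of "`1 + o_m(1)`"
— which is all that the correlation condition (Proposition 9.10, `MeasureCorrelation`) consumes.
The printed proof of Prop. 9.6 (§10 and the Appendix) is a contour-integral computation against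
`ζ` using the classical zero-free region; the bound up to constants has the following elementary
proof, whose abstract core is this file.

After expanding `E ∏_i Λ_R(θ_i)²` and passing to local densities by the Chinese remainder theorem
(the tree's `CFZ.expect_prod_sq_divSum_eq`, `CFZ.tupleDensity_eq_prod_localDensity`), the main term
is an expectation over the product probability space `Ω = ∏_{p ∈ P} ℤ_p`,
`MAIN = E_ω ∏_i (∑_{V ⊆ P} Λ(V) ∏_{p ∈ V} I_i(p, ω_p))²`, with `{0,1}`-valued local indicators
`I_i(p, ·)` of density `a_p = 1/p`. The device of this file (Selberg's diagonalisation, written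
probabilistically):

* `sum_mul_prod_eq_sum_zCoeff_mul_prod` — the change of variables
  `∑_V Λ(V) ∏_{p∈V} x_p = ∑_T z(T) ∏_{p∈T} (x_p − a_p)`, `z(T) = ∑_{V ⊇ T} Λ(V) ∏_{p ∈ V∖T} a_p`
  (one application of `Finset.prod_add`);
* `expect_prod_sq_le_of_zCoeff_le` — THE CORE BOUND: if `|z(T)| ≤ Z ∏_{p∈T} r_p` then
  `MAIN ≤ Z^{2m} ∏_p ∑_{Y ⊆ [m]⊔[m]} r_p^{|Y|} |M_p(Y)|`, `M_p(Y) = E_u ∏_{v∈Y} (I_{idx v}(p,u) − a_p)`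
  (expand the `2m` factors over the slots `[m] ⊔ [m]`, factor the expectation over the primes —
  independence, the tree's `CFZ.expect_pi_prod` — and transpose "slots → sets of primes" into
  "primes → sets of slots", `transposeEquiv`);
* the local moments (`localMoment_*`): `M(∅) = 1`, `M({v}) = 0` (this is where `E I = a` exactly is
  used: the first-order terms cancel, which is the whole point of the change of variables),
  `|M(Y)| ≤ a^{|Y|} + a(1+a)^{|Y|}` always, and `|M(Y)| ≤ a^{|Y|} + 2^{|Y|} a²` when `Y` involves two
  indices whose indicators are disjointly supported (a "generic" prime); summed over `Y`:
  `∑_Y r^{|Y|}|M(Y)| ≤ r^m (1 + C a²)` at a generic prime and `≤ r^m(1 + C a²)(1 + C' a)` in general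
  (`r = (1 − a)⁻¹ = p/(p−1)`), `sum_pow_mul_abs_localMoment_le_generic` / `…_le_general`.

With `∏_{p ≤ R} p/(p−1) ≪ log R` (Mertens) and `|z(T)| ≪ (W/φ(W)) ∏_{p ∈ T} p/(p−1) / log R`
(`CoprimeMoebiusLogSums`), the assembly in `GreenTao2008CorrelationBound.lean` gives
`E ∏_i Λ_R(W(x+h_i)+1)² ≪_m (W log R/φ(W))^m ∏_{p ∣ Δ} (1 + O_m(1/p))`.

## References
* B. Green, T. Tao, Ann. of Math. (2) 167 (2008), 481–547, Proposition 9.6 and §10 (the shape of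
  the local factors, Lemma 10.1 / (10.2)–(10.3)). [cite: GreenTaoAnnals2008]
* A. Selberg, *Sieve methods*, Proc. Sympos. Pure Math. 20 (1971) (the diagonalisation of
  `∑ λ_d λ_e /[d,e]`); H. Halberstam, H.-E. Richert, *Sieve Methods* (1974), Ch. 3. [folklore]
-/

noncomputable section

open Finset
open scoped BigOperators

namespace Literature.NumberTheory.Sieve.GreenTao2008

/-! ### Selberg's change of variables, abstractly -/

section ChangeOfVariables

variable {ι : Type*} [DecidableEq ι]

/-- The diagonalising coefficients `z(T) = ∑_{T ⊆ V ⊆ P} Λ(V) ∏_{p ∈ V ∖ T} a_p`.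
[folklore] -/
def zCoeff (Λ : Finset ι → ℝ) (a : ι → ℝ) (P T : Finset ι) : ℝ :=
  ∑ V ∈ P.powerset with T ⊆ V, Λ V * ∏ p ∈ V \ T, a p

/-- Unfolding `zCoeff`. [folklore] -/
theorem zCoeff_def (Λ : Finset ι → ℝ) (a : ι → ℝ) (P T : Finset ι) :
    zCoeff Λ a P T = ∑ V ∈ P.powerset with T ⊆ V, Λ V * ∏ p ∈ V \ T, a p := rfl

/-- **Selberg's change of variables** (probabilistic form): for any weights `Λ(V)`, `V ⊆ P`, any
"densities" `a_p` and any values `x_p`,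
`∑_{V ⊆ P} Λ(V) ∏_{p ∈ V} x_p = ∑_{T ⊆ P} z(T) ∏_{p ∈ T} (x_p − a_p)`: expand
`∏_{p ∈ V} ((x_p − a_p) + a_p)` by `Finset.prod_add`. [folklore] -/
theorem sum_mul_prod_eq_sum_zCoeff_mul_prod (Λ : Finset ι → ℝ) (a x : ι → ℝ) (P : Finset ι) :
    ∑ V ∈ P.powerset, Λ V * ∏ p ∈ V, x p =
      ∑ T ∈ P.powerset, zCoeff Λ a P T * ∏ p ∈ T, (x p - a p) := by
  -- expand the right-hand side and swap the sums
  have hR : ∑ T ∈ P.powerset, zCoeff Λ a P T * ∏ p ∈ T, (x p - a p) =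
      ∑ T ∈ P.powerset, ∑ V ∈ P.powerset.filter (fun V => T ⊆ V),
        Λ V * ((∏ p ∈ T, (x p - a p)) * ∏ p ∈ V \ T, a p) := by
    refine sum_congr rfl fun T _ => ?_
    rw [zCoeff_def, sum_mul]
    exact sum_congr rfl fun V _ => by ring
  rw [hR, sum_comm' (s' := fun V => V.powerset) (t' := P.powerset)]
  · refine sum_congr rfl fun V _ => ?_
    rw [← mul_sum]
    congr 1
    have hx : ∏ p ∈ V, x p = ∏ p ∈ V, ((x p - a p) + a p) := prod_congr rfl fun p _ => by ring
    rw [hx, prod_add]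
  · intro T V
    simp only [mem_filter, mem_powerset]
    constructor
    · rintro ⟨-, hVP, hTV⟩; exact ⟨hTV, hVP⟩
    · rintro ⟨hTV, hVP⟩; exact ⟨hTV.trans hVP, hVP, hTV⟩

end ChangeOfVariables

/-! ### Transposing a relation between two finite types -/

/-- `(α → Finset β) ≃ (β → Finset α)`: both are the relations between `α` and `β`.
[folklore] -/
def transposeEquiv (α β : Type*) [Fintype α] [Fintype β] [DecidableEq α] [DecidableEq β] :
    (α → Finset β) ≃ (β → Finset α) where
  toFun T := fun b => univ.filter fun a => b ∈ T a
  invFun Y := fun a => univ.filter fun b => a ∈ Y b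
  left_inv T := by funext a; ext b; simp
  right_inv Y := by funext b; ext a; simp

/-- The transpose, evaluated. [folklore] -/
theorem transposeEquiv_apply {α β : Type*} [Fintype α] [Fintype β] [DecidableEq α] [DecidableEq β]
    (T : α → Finset β) (b : β) : transposeEquiv α β T b = univ.filter fun a => b ∈ T a := rfl

/-! ### The product probability space and the core bound -/

section Core

variable {m : ℕ} {ι : Type*} {K : ι → Type*} [∀ p, Fintype (K p)]

/-- The local moments `M_p(Y) = E_{u ∈ K_p} ∏_{v ∈ Y} (I_{idx v}(p, u) − a_p)` of a set of slots
`Y ⊆ [m] ⊔ [m]` (`idx = CFZ.slotIdx` forgets which of the two copies a slot lies in).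
[cite: GreenTaoAnnals2008, Section 10 (local factors, (10.3))] -/
def localMoment (I : Fin m → (p : ι) → K p → ℝ) (a : ι → ℝ) (p : ι) (Y : Finset (Fin m ⊕ Fin m)) : ℝ :=
  𝔼 u : K p, ∏ v ∈ Y, (I (CFZ.slotIdx v) p u - a p)

/-- Unfolding `localMoment`. [cite: GreenTaoAnnals2008, Section 10 (local factors, (10.3))] -/
theorem localMoment_def (I : Fin m → (p : ι) → K p → ℝ) (a : ι → ℝ) (p : ι) (Y : Finset (Fin m ⊕ Fin m)) :
    localMoment I a p Y = 𝔼 u : K p, ∏ v ∈ Y, (I (CFZ.slotIdx v) p u - a p) := rfl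

variable [Fintype ι] [DecidableEq ι]

/-- Regrouping a product over slots and then primes of the slot's set into a product over primes and
then the slots containing it. [folklore] -/
theorem prod_prod_mem_eq_prod_prod_filter {M : Type*} [CommMonoid M]
    (T : Fin m ⊕ Fin m → Finset ι) (g : Fin m ⊕ Fin m → ι → M) :
    ∏ v, ∏ p ∈ T v, g v p = ∏ p, ∏ v ∈ univ.filter (fun v => p ∈ T v), g v p := by
  have h1 : ∀ v : Fin m ⊕ Fin m, ∏ p ∈ T v, g v p = ∏ p, (if p ∈ T v then g v p else 1) := by
    intro v
    rw [prod_ite_mem, univ_inter]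
  simp_rw [h1]
  rw [prod_comm]
  refine prod_congr rfl fun p _ => ?_
  rw [prod_filter]

/-- **The core bound.** In the product space `Ω = ∏_p K_p` with `{0,1}`-free hypotheses (only the
algebra is used here): if the diagonalising coefficients of the weights `Λ` satisfy
`|z(T)| ≤ Z ∏_{p ∈ T} r_p` (`Z ≥ 0`), then
`E_ω ∏_{i<m} (∑_V Λ(V) ∏_{p∈V} I_i(p, ω_p))² ≤ Z^{2m} ∏_p ∑_{Y ⊆ [m]⊔[m]} r_p^{|Y|} |M_p(Y)|`.
Proof: change variables in each of the `2m` factors (slots `[m] ⊔ [m]`), expand the product of sums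
over the slots (`Fintype.prod_sum`), factor the expectation of each term over the primes
(`CFZ.expect_pi_prod`), bound term-wise, and resum over "primes → sets of slots" (`transposeEquiv`,
`Fintype.prod_sum`). [cite: GreenTaoAnnals2008, Proposition 9.6 (weak form)] -/
theorem expect_prod_sq_le_of_zCoeff_le [∀ p, Nonempty (K p)] (I : Fin m → (p : ι) → K p → ℝ) (a : ι → ℝ)
    (Λ : Finset ι → ℝ) (r : ι → ℝ) (Z : ℝ) (hZ : 0 ≤ Z)
    (hzz : ∀ T : Finset ι, |zCoeff Λ a univ T| ≤ Z * ∏ p ∈ T, r p) :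
    𝔼 ω : (∀ p, K p), ∏ i : Fin m, (∑ V : Finset ι, Λ V * ∏ p ∈ V, I i p (ω p)) ^ 2 ≤
      Z ^ (2 * m) * ∏ p, ∑ Y : Finset (Fin m ⊕ Fin m), r p ^ #Y * |localMoment I a p Y| := by
  classical
  set S := Fin m ⊕ Fin m
  set zz : Finset ι → ℝ := zCoeff Λ a univ with hzz_def
  set η : Fin m → Finset ι → (∀ p, K p) → ℝ := fun i T ω => ∏ p ∈ T, (I i p (ω p) - a p) with hη
  -- Step 1: change of variables in each factor
  have h1 : ∀ (i : Fin m) (ω : ∀ p, K p), ∑ V : Finset ι, Λ V * ∏ p ∈ V, I i p (ω p) =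
      ∑ T : Finset ι, zz T * η i T ω := by
    intro i ω
    have h := sum_mul_prod_eq_sum_zCoeff_mul_prod Λ a (fun p => I i p (ω p)) univ
    rw [powerset_univ] at h
    exact h
  -- Step 2: the product of squares as a product over slots, expanded
  have h2 : ∀ ω : ∀ p, K p, ∏ i : Fin m, (∑ V : Finset ι, Λ V * ∏ p ∈ V, I i p (ω p)) ^ 2 =
      ∑ T : S → Finset ι, (∏ v, zz (T v)) * ∏ v, η (CFZ.slotIdx v) (T v) ω := by
    intro ω
    have hsq : ∏ i : Fin m, (∑ V : Finset ι, Λ V * ∏ p ∈ V, I i p (ω p)) ^ 2 =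
        ∏ v : S, (∑ T : Finset ι, zz T * η (CFZ.slotIdx v) T ω) := by
      rw [Fintype.prod_sum_type]
      simp only [CFZ.slotIdx, Sum.elim_inl, Sum.elim_inr, id, ← prod_mul_distrib, sq, h1]
    rw [hsq, Fintype.prod_sum (fun (v : S) (T : Finset ι) => zz T * η (CFZ.slotIdx v) T ω)]
    exact Fintype.sum_congr _ _ fun T => prod_mul_distrib
  -- Step 3: the expectation of each term factors over the primes
  have h3 : ∀ T : S → Finset ι, 𝔼 ω : (∀ p, K p), ∏ v, η (CFZ.slotIdx v) (T v) ω =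
      ∏ p, localMoment I a p (transposeEquiv S ι T p) := by
    intro T
    have hre : ∀ ω : ∀ p, K p, ∏ v, η (CFZ.slotIdx v) (T v) ω =
        ∏ p, ∏ v ∈ univ.filter (fun v => p ∈ T v), (I (CFZ.slotIdx v) p (ω p) - a p) := by
      intro ω
      exact prod_prod_mem_eq_prod_prod_filter T (fun v p => I (CFZ.slotIdx v) p (ω p) - a p)
    simp_rw [hre]
    rw [CFZ.expect_pi_prod (fun p (u : K p) => ∏ v ∈ univ.filter (fun v => p ∈ T v), (I (CFZ.slotIdx v) p u - a p))]
    rfl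
  -- Step 4: the expectation of the expansion, bounded term-wise
  have hexp : 𝔼 ω : (∀ p, K p), ∏ i : Fin m, (∑ V : Finset ι, Λ V * ∏ p ∈ V, I i p (ω p)) ^ 2 =
      ∑ T : S → Finset ι, (∏ v, zz (T v)) * ∏ p, localMoment I a p (transposeEquiv S ι T p) := by
    simp_rw [h2]
    rw [expect_sum_comm]
    refine sum_congr rfl fun T _ => ?_
    rw [← mul_expect, h3]
  rw [hexp]
  have hcard : Fintype.card S = 2 * m := by
    simp only [S, Fintype.card_sum, Fintype.card_fin]; ring
  have hterm : ∀ T : S → Finset ι, (∏ v, zz (T v)) * ∏ p, localMoment I a p (transposeEquiv S ι T p) ≤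
      Z ^ (2 * m) * ∏ p, (r p ^ #(transposeEquiv S ι T p) * |localMoment I a p (transposeEquiv S ι T p)|) := by
    intro T
    refine (le_abs_self _).trans ?_
    rw [abs_mul, abs_prod, abs_prod]
    have hz : ∏ v, |zz (T v)| ≤ ∏ v : S, (Z * ∏ p ∈ T v, r p) :=
      prod_le_prod (fun v _ => abs_nonneg _) (fun v _ => hzz (T v))
    have hZr : ∏ v : S, (Z * ∏ p ∈ T v, r p) = Z ^ (2 * m) * ∏ p, r p ^ #(transposeEquiv S ι T p) := by
      rw [prod_mul_distrib, prod_const, card_univ, hcard]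
      congr 1
      rw [prod_prod_mem_eq_prod_prod_filter T (fun _ p => r p)]
      refine prod_congr rfl fun p _ => ?_
      rw [prod_const, transposeEquiv_apply]
    calc (∏ v, |zz (T v)|) * ∏ p, |localMoment I a p (transposeEquiv S ι T p)|
        ≤ (∏ v : S, (Z * ∏ p ∈ T v, r p)) * ∏ p, |localMoment I a p (transposeEquiv S ι T p)| :=
          mul_le_mul_of_nonneg_right hz (prod_nonneg fun p _ => abs_nonneg _)
      _ = Z ^ (2 * m) * ∏ p, (r p ^ #(transposeEquiv S ι T p) * |localMoment I a p (transposeEquiv S ι T p)|) := by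
          rw [hZr, mul_assoc, ← prod_mul_distrib]
  refine (sum_le_sum fun T _ => hterm T).trans ?_
  rw [← mul_sum]
  refine mul_le_mul_of_nonneg_left (le_of_eq ?_) (pow_nonneg hZ _)
  -- Step 5: transpose and resum
  rw [Fintype.sum_equiv (transposeEquiv S ι)
    (fun T => ∏ p, (r p ^ #(transposeEquiv S ι T p) * |localMoment I a p (transposeEquiv S ι T p)|))
    (fun Y => ∏ p, (r p ^ #(Y p) * |localMoment I a p (Y p)|)) (fun T => rfl)]
  exact (Fintype.prod_sum (fun p (Y : Finset S) => r p ^ #Y * |localMoment I a p Y|)).symm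

end Core

/-! ### The local moments at one prime -/

section Local

variable {m : ℕ} {κ : Type*} [Fintype κ]

/-- The local moment at a single prime: `M(Y) = E_u ∏_{v ∈ Y} (J_{idx v}(u) − a)` for indicator
values `J_i(u)` (`= I_i(p, u)`) and density `a` (`= 1/p`).
[cite: GreenTaoAnnals2008, Section 10 (local factors, (10.3))] -/
def locMoment (J : Fin m → κ → ℝ) (a : ℝ) (Y : Finset (Fin m ⊕ Fin m)) : ℝ :=
  𝔼 u : κ, ∏ v ∈ Y, (J (CFZ.slotIdx v) u - a)

/-- Unfolding `locMoment`. [cite: GreenTaoAnnals2008, Section 10 (local factors, (10.3))] -/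
theorem locMoment_def (J : Fin m → κ → ℝ) (a : ℝ) (Y : Finset (Fin m ⊕ Fin m)) :
    locMoment J a Y = 𝔼 u : κ, ∏ v ∈ Y, (J (CFZ.slotIdx v) u - a) := rfl

/-- `localMoment` of the product space is `locMoment` of the `p`-th factor.
[cite: GreenTaoAnnals2008, Section 10 (local factors, (10.3))] -/
theorem localMoment_eq_locMoment {ι : Type*} {K : ι → Type*} [∀ p, Fintype (K p)]
    (I : Fin m → (p : ι) → K p → ℝ) (a : ι → ℝ) (p : ι) (Y : Finset (Fin m ⊕ Fin m)) :
    localMoment I a p Y = locMoment (fun i => I i p) (a p) Y := rfl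

/-- Expansion of the local moment: `M(Y) = ∑_{U ⊆ Y} (−a)^{|Y∖U|} E_u ∏_{v ∈ U} J_{idx v}(u)`.
[folklore] -/
theorem locMoment_eq_sum_powerset (J : Fin m → κ → ℝ) (a : ℝ) (Y : Finset (Fin m ⊕ Fin m)) :
    locMoment J a Y = ∑ U ∈ Y.powerset, (-a) ^ (#Y - #U) * 𝔼 u : κ, ∏ v ∈ U, J (CFZ.slotIdx v) u := by
  rw [locMoment_def]
  have hexp : ∀ u : κ, ∏ v ∈ Y, (J (CFZ.slotIdx v) u - a) =
      ∑ U ∈ Y.powerset, (-a) ^ (#Y - #U) * ∏ v ∈ U, J (CFZ.slotIdx v) u := by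
    intro u
    have h1 : ∏ v ∈ Y, (J (CFZ.slotIdx v) u - a) = ∏ v ∈ Y, (J (CFZ.slotIdx v) u + (-a)) :=
      prod_congr rfl fun v _ => by ring
    rw [h1, prod_add]
    refine sum_congr rfl fun U hU => ?_
    rw [prod_const, card_sdiff_of_subset (mem_powerset.1 hU), mul_comm]
  simp_rw [hexp]
  rw [expect_sum_comm]
  exact sum_congr rfl fun U _ => (mul_expect _ _ _).symm

variable [Nonempty κ]

/-- `M(∅) = 1`. [folklore] -/
theorem locMoment_empty (J : Fin m → κ → ℝ) (a : ℝ) : locMoment J a ∅ = 1 := by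
  rw [locMoment_def]
  simp only [prod_empty]
  exact expect_const univ_nonempty _

/-- **The first-order terms cancel**: `M({v}) = E(J_{idx v}) − a = 0` when the indicators have
density exactly `a`. [folklore] -/
theorem locMoment_singleton (J : Fin m → κ → ℝ) (a : ℝ) (v : Fin m ⊕ Fin m)
    (hE1 : 𝔼 u : κ, J (CFZ.slotIdx v) u = a) : locMoment J a {v} = 0 := by
  rw [locMoment_def]
  simp only [prod_singleton]
  rw [expect_sub_distrib, hE1, expect_const univ_nonempty, sub_self]

/-- `0 ≤ E ∏_{v ∈ U} J_{idx v} ≤ 1` for `{0,1}`-valued `J`. [folklore] -/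
theorem expect_prod_nonneg_le_one (J : Fin m → κ → ℝ) (hJ : ∀ i u, J i u = 0 ∨ J i u = 1)
    (U : Finset (Fin m ⊕ Fin m)) :
    0 ≤ 𝔼 u : κ, ∏ v ∈ U, J (CFZ.slotIdx v) u ∧ 𝔼 u : κ, ∏ v ∈ U, J (CFZ.slotIdx v) u ≤ 1 := by
  have h0 : ∀ i u, 0 ≤ J i u := fun i u => by rcases hJ i u with h | h <;> simp [h]
  have h1 : ∀ i u, J i u ≤ 1 := fun i u => by rcases hJ i u with h | h <;> simp [h]
  constructor
  · exact expect_nonneg fun u _ => prod_nonneg fun v _ => h0 _ _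
  · calc 𝔼 u : κ, ∏ v ∈ U, J (CFZ.slotIdx v) u ≤ 𝔼 _u : κ, (1 : ℝ) :=
          expect_le_expect fun u _ => prod_le_one (fun v _ => h0 _ _) fun v _ => h1 _ _
      _ = 1 := expect_const univ_nonempty _

/-- **The general local bound**: if every nonempty product of indicators has expectation `≤ a`
(`a ≥ 0`), then `|M(Y)| ≤ a^{|Y|} + a (1 + a)^{|Y|}`. [folklore] -/
theorem abs_locMoment_le (J : Fin m → κ → ℝ) (hJ : ∀ i u, J i u = 0 ∨ J i u = 1) {a : ℝ} (ha : 0 ≤ a)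
    (hE : ∀ U : Finset (Fin m ⊕ Fin m), U.Nonempty → 𝔼 u : κ, ∏ v ∈ U, J (CFZ.slotIdx v) u ≤ a)
    (Y : Finset (Fin m ⊕ Fin m)) :
    |locMoment J a Y| ≤ a ^ #Y + a * (1 + a) ^ #Y := by
  rw [locMoment_eq_sum_powerset]
  -- termwise bound
  have hterm : ∀ U ∈ Y.powerset, |(-a) ^ (#Y - #U) * 𝔼 u : κ, ∏ v ∈ U, J (CFZ.slotIdx v) u| ≤
      (if U = ∅ then a ^ (#Y - #U) else 0) + a * a ^ (#Y - #U) := by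
    intro U _
    have hE0 := expect_prod_nonneg_le_one J hJ U
    rw [abs_mul, abs_pow, abs_neg, abs_of_nonneg ha, abs_of_nonneg hE0.1]
    by_cases hU : U = ∅
    · subst hU
      rw [if_pos rfl]
      simp only [prod_empty, expect_const univ_nonempty]
      nlinarith [pow_nonneg ha (#Y - #(∅ : Finset (Fin m ⊕ Fin m)))]
    · rw [if_neg hU, zero_add]
      have h := hE U (nonempty_iff_ne_empty.2 hU)
      calc a ^ (#Y - #U) * 𝔼 u : κ, ∏ v ∈ U, J (CFZ.slotIdx v) u ≤ a ^ (#Y - #U) * a :=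
            mul_le_mul_of_nonneg_left h (pow_nonneg ha _)
        _ = a * a ^ (#Y - #U) := mul_comm _ _
  calc |∑ U ∈ Y.powerset, (-a) ^ (#Y - #U) * 𝔼 u : κ, ∏ v ∈ U, J (CFZ.slotIdx v) u|
      ≤ ∑ U ∈ Y.powerset, |(-a) ^ (#Y - #U) * 𝔼 u : κ, ∏ v ∈ U, J (CFZ.slotIdx v) u| :=
        abs_sum_le_sum_abs _ _
    _ ≤ ∑ U ∈ Y.powerset, ((if U = ∅ then a ^ (#Y - #U) else 0) + a * a ^ (#Y - #U)) := sum_le_sum hterm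
    _ = a ^ #Y + a * (1 + a) ^ #Y := by
        rw [sum_add_distrib, sum_ite_eq' Y.powerset ∅ (fun U => a ^ (#Y - #U)), if_pos (empty_mem_powerset Y),
          card_empty, Nat.sub_zero, ← mul_sum]
        congr 1
        rw [← sum_pow_mul_eq_add_pow 1 a Y]
        congr 1
        exact sum_congr rfl fun U _ => by rw [one_pow, one_mul]

/-- **The local bound at a generic prime**: if, in addition, every product of indicators involving two
different indices vanishes identically in expectation, and `Y` involves two different indices, then
`|M(Y)| ≤ a^{|Y|} + 2^{|Y|} a²` (`0 ≤ a ≤ 1`): a nonzero term `U ≠ ∅` has all its indices equal, so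
misses a slot of `Y` and carries `(−a)^{|Y∖U|}` with `|Y∖U| ≥ 1`. [folklore] -/
theorem abs_locMoment_le_generic (J : Fin m → κ → ℝ) (hJ : ∀ i u, J i u = 0 ∨ J i u = 1) {a : ℝ}
    (ha : 0 ≤ a) (ha1 : a ≤ 1)
    (hE : ∀ U : Finset (Fin m ⊕ Fin m), U.Nonempty → 𝔼 u : κ, ∏ v ∈ U, J (CFZ.slotIdx v) u ≤ a)
    (hgen : ∀ U : Finset (Fin m ⊕ Fin m), (∃ v ∈ U, ∃ v' ∈ U, CFZ.slotIdx v ≠ CFZ.slotIdx v') →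
      𝔼 u : κ, ∏ v ∈ U, J (CFZ.slotIdx v) u = 0)
    {Y : Finset (Fin m ⊕ Fin m)} (hY : ∃ v ∈ Y, ∃ v' ∈ Y, CFZ.slotIdx v ≠ CFZ.slotIdx v') :
    |locMoment J a Y| ≤ a ^ #Y + 2 ^ #Y * a ^ 2 := by
  rw [locMoment_eq_sum_powerset]
  obtain ⟨v₁, hv₁, v₂, hv₂, hne⟩ := hY
  have hterm : ∀ U ∈ Y.powerset, |(-a) ^ (#Y - #U) * 𝔼 u : κ, ∏ v ∈ U, J (CFZ.slotIdx v) u| ≤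
      (if U = ∅ then a ^ #Y else 0) + a ^ 2 := by
    intro U hU
    have hUY : U ⊆ Y := mem_powerset.1 hU
    have hE0 := expect_prod_nonneg_le_one J hJ U
    rw [abs_mul, abs_pow, abs_neg, abs_of_nonneg ha, abs_of_nonneg hE0.1]
    by_cases hU0 : U = ∅
    · subst hU0
      rw [if_pos rfl]
      simp only [prod_empty, expect_const univ_nonempty, card_empty, Nat.sub_zero, mul_one]
      nlinarith
    rw [if_neg hU0, zero_add]
    by_cases hmix : ∃ v ∈ U, ∃ v' ∈ U, CFZ.slotIdx v ≠ CFZ.slotIdx v'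
    · rw [hgen U hmix, mul_zero]; positivity
    · -- all indices of `U` agree, so `U` misses `v₁` or `v₂`
      push Not at hmix
      have hlt : #U < #Y := by
        refine card_lt_card ⟨hUY, fun hYU => ?_⟩
        exact hne (hmix v₁ (hYU hv₁) v₂ (hYU hv₂))
      have hk : 1 ≤ #Y - #U := by omega
      have h1 : a ^ (#Y - #U) ≤ a := by
        calc a ^ (#Y - #U) ≤ a ^ 1 := pow_le_pow_of_le_one ha ha1 hk
          _ = a := pow_one a
      have h2 := hE U (nonempty_iff_ne_empty.2 hU0)
      calc a ^ (#Y - #U) * 𝔼 u : κ, ∏ v ∈ U, J (CFZ.slotIdx v) u ≤ a * a :=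
            mul_le_mul h1 h2 hE0.1 ha
        _ = a ^ 2 := (sq a).symm
  calc |∑ U ∈ Y.powerset, (-a) ^ (#Y - #U) * 𝔼 u : κ, ∏ v ∈ U, J (CFZ.slotIdx v) u|
      ≤ ∑ U ∈ Y.powerset, |(-a) ^ (#Y - #U) * 𝔼 u : κ, ∏ v ∈ U, J (CFZ.slotIdx v) u| :=
        abs_sum_le_sum_abs _ _
    _ ≤ ∑ U ∈ Y.powerset, ((if U = ∅ then a ^ #Y else 0) + a ^ 2) := sum_le_sum hterm
    _ = a ^ #Y + 2 ^ #Y * a ^ 2 := by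
        rw [sum_add_distrib, sum_ite_eq' Y.powerset ∅ (fun _ => a ^ #Y), if_pos (empty_mem_powerset Y),
          sum_const, card_powerset, nsmul_eq_mul]
        push_cast
        ring

/-- The pair of slots `{inl i, inr i}` carrying the index `i`. [folklore] -/
def slotPair (i : Fin m) : Finset (Fin m ⊕ Fin m) := {Sum.inl i, Sum.inr i}

/-- `|slotPair i| = 2`. [folklore] -/
theorem card_slotPair (i : Fin m) : #(slotPair i) = 2 := by
  unfold slotPair
  rw [card_insert_of_notMem (by simp), card_singleton]

/-- A set of slots all carrying the same index lies in a `slotPair`. [folklore] -/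
theorem subset_slotPair_of_forall {Y : Finset (Fin m ⊕ Fin m)}
    (h : ∀ v ∈ Y, ∀ v' ∈ Y, CFZ.slotIdx v = CFZ.slotIdx v') {v₀ : Fin m ⊕ Fin m} (hv₀ : v₀ ∈ Y) :
    Y ⊆ slotPair (CFZ.slotIdx v₀) := by
  intro v hv
  have he := h v hv v₀ hv₀
  unfold slotPair
  rw [← he]
  rcases v with i | i <;> simp [CFZ.slotIdx]

/-- The number of sets of slots is `4^m`. [folklore] -/
theorem card_finset_slots (m : ℕ) : Fintype.card (Finset (Fin m ⊕ Fin m)) = 4 ^ m := by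
  rw [Fintype.card_finset, Fintype.card_sum, Fintype.card_fin, ← two_mul, pow_mul]
  norm_num

/-- **The local factor at a general prime**: with `r ≥ 1`, `0 ≤ a ≤ 1` and indicators of density
exactly `a`, `∑_{Y} r^{|Y|} |M(Y)| ≤ 1 + 4^m r^{2m} (a² + a (1+a)^{2m})`
(`Y = ∅` gives `1`, singletons give `0`, and there are at most `4^m` sets `Y` with `|Y| ≥ 2`).
[cite: GreenTaoAnnals2008, Proposition 9.6 (weak form)] -/
theorem sum_pow_mul_abs_locMoment_le_general (J : Fin m → κ → ℝ) (hJ : ∀ i u, J i u = 0 ∨ J i u = 1)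
    {a r : ℝ} (ha : 0 ≤ a) (ha1 : a ≤ 1) (hr : 1 ≤ r)
    (hE1 : ∀ i, 𝔼 u : κ, J i u = a)
    (hE : ∀ U : Finset (Fin m ⊕ Fin m), U.Nonempty → 𝔼 u : κ, ∏ v ∈ U, J (CFZ.slotIdx v) u ≤ a) :
    ∑ Y : Finset (Fin m ⊕ Fin m), r ^ #Y * |locMoment J a Y| ≤
      1 + 4 ^ m * (r ^ (2 * m) * (a ^ 2 + a * (1 + a) ^ (2 * m))) := by
  set B : ℝ := r ^ (2 * m) * (a ^ 2 + a * (1 + a) ^ (2 * m)) with hB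
  have hB0 : 0 ≤ B := by positivity
  have hterm : ∀ Y : Finset (Fin m ⊕ Fin m), r ^ #Y * |locMoment J a Y| ≤ (if Y = ∅ then 1 else 0) + B := by
    intro Y
    by_cases hY0 : Y = ∅
    · subst hY0
      rw [if_pos rfl, locMoment_empty, card_empty, pow_zero, abs_one, mul_one]
      linarith
    rw [if_neg hY0, zero_add]
    by_cases hY1 : #Y = 1
    · obtain ⟨v, rfl⟩ := card_eq_one.1 hY1
      rw [locMoment_singleton J a v (hE1 _), abs_zero, mul_zero]
      exact hB0
    have hY2 : 2 ≤ #Y := by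
      have : #Y ≠ 0 := fun h => hY0 (card_eq_zero.1 h)
      omega
    have hYle : #Y ≤ 2 * m := by
      have := card_le_univ Y
      rwa [Fintype.card_sum, Fintype.card_fin, ← two_mul] at this
    have h1 : r ^ #Y ≤ r ^ (2 * m) := pow_le_pow_right₀ hr hYle
    have h2 : |locMoment J a Y| ≤ a ^ 2 + a * (1 + a) ^ (2 * m) := by
      refine (abs_locMoment_le J hJ ha hE Y).trans (add_le_add ?_ ?_)
      · exact pow_le_pow_of_le_one ha ha1 hY2
      · exact mul_le_mul_of_nonneg_left (pow_le_pow_right₀ (by linarith) hYle) ha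
    exact mul_le_mul h1 h2 (abs_nonneg _) (by positivity)
  calc ∑ Y : Finset (Fin m ⊕ Fin m), r ^ #Y * |locMoment J a Y|
      ≤ ∑ Y : Finset (Fin m ⊕ Fin m), ((if Y = ∅ then (1 : ℝ) else 0) + B) := sum_le_sum fun Y _ => hterm Y
    _ = 1 + 4 ^ m * B := by
        rw [sum_add_distrib, sum_ite_eq' univ (∅ : Finset (Fin m ⊕ Fin m)) (fun _ => (1 : ℝ)), if_pos (mem_univ _),
          sum_const, card_univ, card_finset_slots, nsmul_eq_mul]
        push_cast
        ring

/-- **The local factor at a generic prime**: if moreover the indicators of different indices are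
disjointly supported (`E ∏_{v ∈ U} J_{idx v} = 0` as soon as `U` involves two indices), then
`∑_Y r^{|Y|}|M(Y)| ≤ 1 + m r² (a² + a(1+a)²) + 4^m r^{2m} (1 + 4^m) a²` — the only sets `Y` with
`|Y| ≥ 2` not covered by the generic bound are the `m` pairs `{inl i, inr i}`.
[cite: GreenTaoAnnals2008, Proposition 9.6 (weak form)] -/
theorem sum_pow_mul_abs_locMoment_le_generic (J : Fin m → κ → ℝ) (hJ : ∀ i u, J i u = 0 ∨ J i u = 1)
    {a r : ℝ} (ha : 0 ≤ a) (ha1 : a ≤ 1) (hr : 1 ≤ r)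
    (hE1 : ∀ i, 𝔼 u : κ, J i u = a)
    (hE : ∀ U : Finset (Fin m ⊕ Fin m), U.Nonempty → 𝔼 u : κ, ∏ v ∈ U, J (CFZ.slotIdx v) u ≤ a)
    (hgen : ∀ U : Finset (Fin m ⊕ Fin m), (∃ v ∈ U, ∃ v' ∈ U, CFZ.slotIdx v ≠ CFZ.slotIdx v') →
      𝔼 u : κ, ∏ v ∈ U, J (CFZ.slotIdx v) u = 0) :
    ∑ Y : Finset (Fin m ⊕ Fin m), r ^ #Y * |locMoment J a Y| ≤
      1 + m * (r ^ 2 * (a ^ 2 + a * (1 + a) ^ 2)) + 4 ^ m * (r ^ (2 * m) * ((1 + 4 ^ m) * a ^ 2)) := by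
  classical
  set B₁ : ℝ := r ^ 2 * (a ^ 2 + a * (1 + a) ^ 2) with hB₁
  set B₂ : ℝ := r ^ (2 * m) * ((1 + 4 ^ m) * a ^ 2) with hB₂
  have hB₁0 : 0 ≤ B₁ := by positivity
  have hB₂0 : 0 ≤ B₂ := by positivity
  have hterm : ∀ Y : Finset (Fin m ⊕ Fin m), r ^ #Y * |locMoment J a Y| ≤
      (if Y = ∅ then 1 else 0) + (∑ i : Fin m, if Y = slotPair i then B₁ else 0) + B₂ := by
    intro Y
    have hS0 : 0 ≤ ∑ i : Fin m, (if Y = slotPair i then B₁ else 0) :=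
      sum_nonneg fun i _ => by split_ifs <;> [exact hB₁0; exact le_rfl]
    by_cases hY0 : Y = ∅
    · subst hY0
      rw [if_pos rfl, locMoment_empty, card_empty, pow_zero, abs_one, mul_one]
      linarith
    rw [if_neg hY0, zero_add]
    by_cases hY1 : #Y = 1
    · obtain ⟨v, rfl⟩ := card_eq_one.1 hY1
      rw [locMoment_singleton J a v (hE1 _), abs_zero, mul_zero]
      positivity
    have hY2 : 2 ≤ #Y := by
      have : #Y ≠ 0 := fun h => hY0 (card_eq_zero.1 h)
      omega
    have hYle : #Y ≤ 2 * m := by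
      have := card_le_univ Y
      rwa [Fintype.card_sum, Fintype.card_fin, ← two_mul] at this
    by_cases hmix : ∃ v ∈ Y, ∃ v' ∈ Y, CFZ.slotIdx v ≠ CFZ.slotIdx v'
    · -- generic bound
      have h1 : r ^ #Y ≤ r ^ (2 * m) := pow_le_pow_right₀ hr hYle
      have h2 : |locMoment J a Y| ≤ (1 + 4 ^ m) * a ^ 2 := by
        refine (abs_locMoment_le_generic J hJ ha ha1 hE hgen hmix).trans ?_
        have h3 : a ^ #Y ≤ a ^ 2 := pow_le_pow_of_le_one ha ha1 hY2
        have h4 : (2 : ℝ) ^ #Y ≤ 4 ^ m := by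
          calc (2 : ℝ) ^ #Y ≤ 2 ^ (2 * m) := pow_le_pow_right₀ (by norm_num) hYle
            _ = 4 ^ m := by rw [pow_mul]; norm_num
        nlinarith [sq_nonneg a]
      calc r ^ #Y * |locMoment J a Y| ≤ r ^ (2 * m) * ((1 + 4 ^ m) * a ^ 2) :=
            mul_le_mul h1 h2 (abs_nonneg _) (by positivity)
        _ = B₂ := rfl
        _ ≤ _ := by linarith
    · -- `Y` is a pair `{inl i, inr i}`
      push Not at hmix
      obtain ⟨v₀, hv₀⟩ := nonempty_iff_ne_empty.2 hY0
      set i₀ := CFZ.slotIdx v₀ with hi₀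
      have hsub : Y ⊆ slotPair i₀ := subset_slotPair_of_forall hmix hv₀
      have hYeq : Y = slotPair i₀ :=
        eq_of_subset_of_card_le hsub (by rw [card_slotPair]; exact hY2)
      have hcard : #Y = 2 := by rw [hYeq, card_slotPair]
      have h2 : |locMoment J a Y| ≤ a ^ 2 + a * (1 + a) ^ 2 := by
        have := abs_locMoment_le J hJ ha hE Y
        rwa [hcard] at this
      have hle : r ^ #Y * |locMoment J a Y| ≤ B₁ := by
        rw [hcard]
        exact mul_le_mul_of_nonneg_left h2 (by positivity)
      have hsum : B₁ ≤ ∑ i : Fin m, (if Y = slotPair i then B₁ else 0) := by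
        calc B₁ = if Y = slotPair i₀ then B₁ else 0 := by rw [if_pos hYeq]
          _ ≤ ∑ i : Fin m, (if Y = slotPair i then B₁ else 0) :=
              single_le_sum (f := fun i => if Y = slotPair i then B₁ else 0)
                (fun i _ => by split_ifs <;> [exact hB₁0; exact le_rfl]) (mem_univ i₀)
      linarith
  -- sum the termwise bound
  have hpairs : ∑ Y : Finset (Fin m ⊕ Fin m), ∑ i : Fin m, (if Y = slotPair i then B₁ else 0) = m * B₁ := by
    rw [sum_comm]
    have : ∀ i : Fin m, ∑ Y : Finset (Fin m ⊕ Fin m), (if Y = slotPair i then B₁ else 0) = B₁ := by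
      intro i
      rw [sum_ite_eq' univ (slotPair i) (fun _ => B₁), if_pos (mem_univ _)]
    simp only [this, sum_const, card_univ, Fintype.card_fin, nsmul_eq_mul]
  calc ∑ Y : Finset (Fin m ⊕ Fin m), r ^ #Y * |locMoment J a Y|
      ≤ ∑ Y : Finset (Fin m ⊕ Fin m),
          ((if Y = ∅ then (1 : ℝ) else 0) + (∑ i : Fin m, if Y = slotPair i then B₁ else 0) + B₂) :=
        sum_le_sum fun Y _ => hterm Y
    _ = 1 + m * B₁ + 4 ^ m * B₂ := by
        rw [sum_add_distrib, sum_add_distrib, hpairs,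
          sum_ite_eq' univ (∅ : Finset (Fin m ⊕ Fin m)) (fun _ => (1 : ℝ)), if_pos (mem_univ _),
          sum_const, card_univ, card_finset_slots, nsmul_eq_mul]
        push_cast
        ring

end Local

/-! ### The local factors as `(p/(p-1))^m (1 + O(1/p²))` and `(1 + O(1/p))` -/

section Numeric

/-- The constant in the generic local factor `r^m (1 + coreConst m · a²)` (`a = 1/p`, `r = p/(p-1)`).
[cite: GreenTaoAnnals2008, Proposition 9.6 (weak form)] -/
def coreConst (m : ℕ) : ℝ := 20 * m + 16 ^ m * (1 + 4 ^ m)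

/-- The constant in the exceptional local factor `1 + excConst m · a`.
[cite: GreenTaoAnnals2008, Proposition 9.6 (weak form)] -/
def excConst (m : ℕ) : ℝ := 16 ^ m * (1 + (9 / 4 : ℝ) ^ m)

/-- `coreConst m ≥ 0`. [cite: GreenTaoAnnals2008, Proposition 9.6 (weak form)] -/
theorem coreConst_nonneg (m : ℕ) : 0 ≤ coreConst m := by unfold coreConst; positivity

/-- `excConst m ≥ 0`. [cite: GreenTaoAnnals2008, Proposition 9.6 (weak form)] -/
theorem excConst_nonneg (m : ℕ) : 0 ≤ excConst m := by unfold excConst; positivity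

/-- Elementary facts about `r = (1 - a)⁻¹` for `0 < a ≤ 1/2`: `1 ≤ r ≤ 2` and `r a = r - 1`.
[folklore] -/
theorem inv_one_sub_bounds {a : ℝ} (ha0 : 0 < a) (ha : a ≤ 1 / 2) :
    1 ≤ (1 - a)⁻¹ ∧ (1 - a)⁻¹ ≤ 2 ∧ (1 - a)⁻¹ * a = (1 - a)⁻¹ - 1 := by
  have h1 : 0 < 1 - a := by linarith
  refine ⟨?_, ?_, ?_⟩
  · rw [le_inv_comm₀ one_pos h1, inv_one]; linarith
  · rw [inv_le_comm₀ h1 two_pos]; linarith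
  · field_simp
    ring

/-- **The generic local factor**: for `0 < a ≤ 1/2` and `r = (1-a)⁻¹`,
`1 + m r² (a² + a(1+a)²) + 4^m r^{2m} (1 + 4^m) a² ≤ r^m (1 + coreConst m · a²)`
(the first-order term `m r a = m (r - 1)` is absorbed by Bernoulli: `1 + m(r-1) ≤ r^m`).
[cite: GreenTaoAnnals2008, Proposition 9.6 (weak form)] -/
theorem generic_factor_le {m : ℕ} {a : ℝ} (ha0 : 0 < a) (ha : a ≤ 1 / 2) :
    1 + m * ((1 - a)⁻¹ ^ 2 * (a ^ 2 + a * (1 + a) ^ 2)) +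
        4 ^ m * ((1 - a)⁻¹ ^ (2 * m) * ((1 + 4 ^ m) * a ^ 2)) ≤
      (1 - a)⁻¹ ^ m * (1 + coreConst m * a ^ 2) := by
  obtain ⟨hr1, hr2, hra⟩ := inv_one_sub_bounds ha0 ha
  set r := (1 - a)⁻¹ with hr
  have hm0 : (0 : ℝ) ≤ m := Nat.cast_nonneg m
  have ha1 : a ≤ 1 := by linarith
  -- the pair term
  have e1 : r * (1 + a) ^ 2 = 1 + r * a * (3 + a) := by linear_combination (-1 : ℝ) * hra
  have t1 : r ^ 2 * (a ^ 2 + a * (1 + a) ^ 2) ≤ r * a + 20 * a ^ 2 := by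
    have e2 : r ^ 2 * (a ^ 2 + a * (1 + a) ^ 2) = r ^ 2 * a ^ 2 + r * a + r ^ 2 * a ^ 2 * (3 + a) := by
      have : r ^ 2 * (a * (1 + a) ^ 2) = r * a * (r * (1 + a) ^ 2) := by ring
      rw [mul_add, this, e1]; ring
    rw [e2]
    have hr4 : r ^ 2 ≤ 4 := by nlinarith
    have h3 : r ^ 2 * a ^ 2 ≤ 4 * a ^ 2 := by nlinarith [sq_nonneg a]
    have h4 : r ^ 2 * a ^ 2 * (3 + a) ≤ 4 * a ^ 2 * 4 := by
      have := mul_le_mul h3 (show 3 + a ≤ 4 by linarith) (by linarith) (by positivity)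
      linarith
    linarith
  -- the generic term
  have t2 : (4 : ℝ) ^ m * (r ^ (2 * m) * ((1 + 4 ^ m) * a ^ 2)) ≤ 16 ^ m * (1 + 4 ^ m) * a ^ 2 := by
    have hr2m : r ^ (2 * m) ≤ 4 ^ m := by
      calc r ^ (2 * m) ≤ 2 ^ (2 * m) := pow_le_pow_left₀ (by linarith) hr2 _
        _ = 4 ^ m := by rw [pow_mul]; norm_num
    have h16 : (16 : ℝ) ^ m = 4 ^ m * 4 ^ m := by rw [← mul_pow]; norm_num
    rw [h16]
    have h0 : (0 : ℝ) ≤ (1 + 4 ^ m) * a ^ 2 := by positivity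
    have h4 : (0 : ℝ) ≤ 4 ^ m := by positivity
    calc (4 : ℝ) ^ m * (r ^ (2 * m) * ((1 + 4 ^ m) * a ^ 2)) ≤ 4 ^ m * (4 ^ m * ((1 + 4 ^ m) * a ^ 2)) :=
          mul_le_mul_of_nonneg_left (mul_le_mul_of_nonneg_right hr2m h0) h4
      _ = 4 ^ m * 4 ^ m * (1 + 4 ^ m) * a ^ 2 := by ring
  -- Bernoulli
  have tB : 1 + m * (r * a) ≤ r ^ m := by
    have h := one_add_mul_le_pow (show (-2 : ℝ) ≤ r * a by nlinarith) m
    rwa [show 1 + r * a = r by rw [hra]; ring] at h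
  have hrm : 1 ≤ r ^ m := one_le_pow₀ hr1
  have hC : 0 ≤ coreConst m * a ^ 2 := mul_nonneg (coreConst_nonneg m) (sq_nonneg a)
  calc 1 + m * (r ^ 2 * (a ^ 2 + a * (1 + a) ^ 2)) + 4 ^ m * (r ^ (2 * m) * ((1 + 4 ^ m) * a ^ 2))
      ≤ 1 + m * (r * a + 20 * a ^ 2) + 16 ^ m * (1 + 4 ^ m) * a ^ 2 := by
        gcongr
    _ = (1 + m * (r * a)) + coreConst m * a ^ 2 := by unfold coreConst; ring
    _ ≤ r ^ m + r ^ m * (coreConst m * a ^ 2) := by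
        apply add_le_add tB
        calc coreConst m * a ^ 2 = 1 * (coreConst m * a ^ 2) := (one_mul _).symm
          _ ≤ r ^ m * (coreConst m * a ^ 2) := mul_le_mul_of_nonneg_right hrm hC
    _ = r ^ m * (1 + coreConst m * a ^ 2) := by ring

/-- **The exceptional local factor**: for `0 < a ≤ 1/2` and `r = (1-a)⁻¹`,
`1 + 4^m r^{2m} (a² + a(1+a)^{2m}) ≤ 1 + excConst m · a`.
[cite: GreenTaoAnnals2008, Proposition 9.6 (weak form)] -/
theorem general_factor_le {m : ℕ} {a : ℝ} (ha0 : 0 < a) (ha : a ≤ 1 / 2) :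
    1 + 4 ^ m * ((1 - a)⁻¹ ^ (2 * m) * (a ^ 2 + a * (1 + a) ^ (2 * m))) ≤ 1 + excConst m * a := by
  obtain ⟨hr1, hr2, -⟩ := inv_one_sub_bounds ha0 ha
  set r := (1 - a)⁻¹ with hr
  have hr2m : r ^ (2 * m) ≤ 4 ^ m := by
    calc r ^ (2 * m) ≤ 2 ^ (2 * m) := pow_le_pow_left₀ (by linarith) hr2 _
      _ = 4 ^ m := by rw [pow_mul]; norm_num
  have h9 : (1 + a) ^ (2 * m) ≤ (9 / 4 : ℝ) ^ m := by
    calc (1 + a) ^ (2 * m) ≤ (3 / 2 : ℝ) ^ (2 * m) := pow_le_pow_left₀ (by linarith) (by linarith) _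
      _ = (9 / 4 : ℝ) ^ m := by rw [pow_mul]; norm_num
  have hin : a ^ 2 + a * (1 + a) ^ (2 * m) ≤ a * (1 + (9 / 4 : ℝ) ^ m) := by
    have : a ^ 2 ≤ a * 1 := by nlinarith
    nlinarith [mul_le_mul_of_nonneg_left h9 ha0.le]
  have h16 : (16 : ℝ) ^ m = 4 ^ m * 4 ^ m := by rw [← mul_pow]; norm_num
  have h0 : 0 ≤ a ^ 2 + a * (1 + a) ^ (2 * m) := by positivity
  calc 1 + 4 ^ m * (r ^ (2 * m) * (a ^ 2 + a * (1 + a) ^ (2 * m)))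
      ≤ 1 + 4 ^ m * (4 ^ m * (a * (1 + (9 / 4 : ℝ) ^ m))) := by
        gcongr 1 + 4 ^ m * ?_
        exact mul_le_mul hr2m hin h0 (by positivity)
    _ = 1 + excConst m * a := by unfold excConst; rw [h16]; ring

end Numeric

end Literature.NumberTheory.Sieve.GreenTao2008
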